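import Mathlib
import HarnessLib

/-!
# The Taylor polynomial reproduces the jet: `(f − T_n f)^{(j)}(R) = 0` for `j ≤ n`

Analysis/Calculus support file (everything proved). With
`T(x) = Σ_{m ≤ n} f^{(m)}(R) (x − R)^m / m!` (written with `iteratedDeriv`):
`iteratedDeriv j T R = iteratedDeriv j f R` for `j ≤ n` (`iteratedDeriv_taylorSum`), `T ∈ C^∞`,
hence `k = f − T` satisfies `k^{(j)}(R) = 0` for all `j ≤ n` (`iteratedDeriv_sub_taylorSum`). This is
the normalisation feeding the Hardy chains (`HardyChainHalfLine.lean`) in the coercivity of the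
Darboux ladder modulo kernel data (`InverseSquareLadderCoercivity.lean`; route PhotonSphereChannels,
`FixedModeChannels`, far side, stmt-FinalStateConjecture-10048). Folklore.
-/

noncomputable section

namespace Literature.Analysis.Calculus

open Finset

/-- Jet of a shifted monomial at its centre: `((x−R)^m)^{(j)}(R) = m! [j = m]`. [folklore] -/
theorem iteratedDeriv_pow_sub_center (m j : ℕ) (R : ℝ) :
    iteratedDeriv j (fun x : ℝ => (x - R) ^ m) R = if j = m then (m.factorial : ℝ) else 0 := by
  have h := congrFun (iteratedDeriv_comp_sub_const (n := j) (f := fun y : ℝ => y ^ m) (s := R)) R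
  simp only [sub_self] at h
  rw [h, iteratedDeriv_fun_pow_zero (𝕜 := ℝ)]
  push_cast
  split_ifs <;> rfl

/-- **The Taylor sum has the prescribed jet.** [folklore] -/
theorem iteratedDeriv_taylorSum (c : ℕ → ℝ) (n : ℕ) (R : ℝ) {j : ℕ} (hj : j ≤ n) :
    iteratedDeriv j (fun x : ℝ => ∑ m ∈ range (n + 1), c m / m.factorial * (x - R) ^ m) R = c j := by
  have hsmooth : ∀ m ∈ range (n + 1),
      ContDiffAt ℝ j (fun x : ℝ => c m / m.factorial * (x - R) ^ m) R := fun m _ =>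
    (contDiff_const.mul ((contDiff_id.sub contDiff_const).pow m)).contDiffAt
  rw [iteratedDeriv_fun_sum hsmooth]
  have hterm : ∀ m ∈ range (n + 1),
      iteratedDeriv j (fun x : ℝ => c m / m.factorial * (x - R) ^ m) R
        = if j = m then c m else 0 := by
    intro m _
    rw [iteratedDeriv_const_mul _ ((contDiff_id.sub contDiff_const).pow m |>.contDiffAt
      |>.of_le le_top), iteratedDeriv_pow_sub_center]
    split_ifs with h
    · subst h
      have : (j.factorial : ℝ) ≠ 0 := by exact_mod_cast j.factorial_ne_zero
      field_simp
    · simp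
  rw [sum_congr rfl hterm, sum_ite_eq]
  simp [Nat.lt_succ_of_le hj]

/-- The Taylor sum is smooth. [folklore] -/
theorem contDiff_taylorSum (c : ℕ → ℝ) (n : ℕ) (R : ℝ) {N : ℕ∞} :
    ContDiff ℝ N (fun x : ℝ => ∑ m ∈ range (n + 1), c m / m.factorial * (x - R) ^ m) :=
  ContDiff.sum fun m _ => contDiff_const.mul ((contDiff_id.sub contDiff_const).pow m)

/-- **Subtracting the Taylor polynomial kills the jet**: for `f ∈ Cⁿ` and
`T(x) = Σ_{m≤n} f^{(m)}(R)(x−R)^m/m!`, `(f − T)^{(j)}(R) = 0` for all `j ≤ n`. [folklore] -/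
theorem iteratedDeriv_sub_taylorSum {f : ℝ → ℝ} {n : ℕ} (hf : ContDiff ℝ n f) (R : ℝ) {j : ℕ}
    (hj : j ≤ n) :
    iteratedDeriv j (fun x => f x - ∑ m ∈ range (n + 1),
      iteratedDeriv m f R / m.factorial * (x - R) ^ m) R = 0 := by
  have hfj : ContDiffAt ℝ j f R := (hf.of_le (by exact_mod_cast hj)).contDiffAt
  have hTj : ContDiffAt ℝ j
      (fun x : ℝ => ∑ m ∈ range (n + 1), iteratedDeriv m f R / m.factorial * (x - R) ^ m) R :=
    (contDiff_taylorSum (fun m => iteratedDeriv m f R) n R).contDiffAt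
  rw [iteratedDeriv_fun_sub hfj hTj, iteratedDeriv_taylorSum _ n R hj, sub_self]

end Literature.Analysis.Calculus
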